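import Literature.NumberTheory.EllipticCurves.ShintaniAnisotropicOrbits
import Literature.NumberTheory.EllipticCurves.ShintaniSplitStabilizers
import Literature.NumberTheory.EllipticCurves.HaberlandStokesProofs
import Mathlib.Analysis.SpecialFunctions.Pow.Asymptotics
import HarnessLib

/-!
# The orbit integral of a split indefinite vector: the cusp-to-cusp period

[[cite: Shintani1975, §2, Prop. 2.4 and proof of Prop. 2.3 (pp. 104–106)]] — for an indefinite
vector whose form has RATIONAL roots (square discriminant) the stabiliser is trivial
(`ShintaniSplitStabilizers`), the orbit integral runs over all of `ℍ`, and moving the roots to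
`∞, 0` (`x ∘ M = λXY`) it becomes `∫_{Im>0} (Im w)⁻² (φ|M)(w) K w e^{-c(Re w/Im w)²} dw`, evaluated by
`ShintaniOrbitIntegrals.integral_sectorSet_Ioi_eq_mul_sqrt` as `√(π/c)` times the complete period
`∫₀^∞ (φ|M)(iy) i dy` of `φ` between the two cusps `M∞`, `M0`.  We PROVE the analytic hypotheses
of that evaluation for `φ ∈ S₂(Γ₀(64))` and conclude:

* `tendsto_pow_mul_norm_cusp` — `rⁿ ‖φ((AN)(re^{iθ}))‖ → 0` (`A ∈ SL₂(ℤ)`, `N` upper triangular):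
  exponential decay of `φ|A` at `i∞` (tree: `isCuspFunction_slash`, `HaberlandStokes.exists_norm_apply_le`);
* `exists_sl2z_mul_upper` (Bezout factorisation `M = AN` when `M∞` is rational),
  `isotropic_dir_rational`, `exists_factorizations_of_sq` — for split `k₀` both `M∞` and `M0`
  are cusps;
* `tendsto_slashSL_mul_atTop`, `tendsto_slashSL_mul_nhdsGT_zero` (ray decay at `∞` and `0`, the
  latter through `S`), `integrableOn_ray`, `integrableOn_polarIntegrand_of_plane` (polar transfer
  of integrability, `Complex.lintegral_comp_polarCoord_symm`);
* **`orbitIntegral_split`** — `J(ω) = c_D(k_ω) λ e(λ²Z) · (∫₀^∞ (φ|M)(iy) i dy) · √(π/(4π Im Z λ²))`.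

No named facts, no new definitions.
-/

noncomputable section

open scoped MatrixGroups ModularForm Modular Topology ENNReal Pointwise Manifold
open UpperHalfPlane hiding I
open Complex Filter MeasureTheory Set CongruenceSubgroup ModularGroup Real MulAction Asymptotics
open Literature.NumberTheory.EllipticCurves.ModularForms

namespace Literature.NumberTheory.EllipticCurves.Shintani

/-! ### Decay of `φ` at a cusp, seen through a real matrix fixing the direction of the cusp -/

/-- The point of the ray: `ofComplex (r e^{iθ})` has coordinate `r e^{iθ}` for `r > 0`,
`θ ∈ (0, π)`. [folklore] -/
theorem coe_ofComplex_polarPt {r θ : ℝ} (hr : 0 < r) (hθ : θ ∈ Ioo 0 π) :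
    ((UpperHalfPlane.ofComplex (polarPt r θ) : ℍ) : ℂ) = polarPt r θ := by
  have him : 0 < (polarPt r θ).im := by
    rw [polarPt_im]
    exact mul_pos hr (Real.sin_pos_of_pos_of_lt_pi hθ.1 hθ.2)
  rw [UpperHalfPlane.ofComplex_apply_of_im_pos him]

/-- For upper triangular `N ∈ SL₂(ℝ)`: `(N u) = N₀₀² u + N₀₀ N₀₁`. [folklore] -/
theorem coe_upper_smul (Nu : SL(2, ℝ)) (hN : (Nu 1 0 : ℝ) = 0) (u : ℍ) :
    (((Nu • u : ℍ)) : ℂ) = ((Nu 0 0 : ℝ) : ℂ) ^ 2 * u + ((Nu 0 0 : ℝ) : ℂ) * ((Nu 0 1 : ℝ) : ℂ) := by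
  have hdet := det_entries_real Nu
  rw [hN, mul_zero, sub_zero] at hdet
  have h11 : ((Nu 1 1 : ℝ) : ℂ) = (((Nu 0 0 : ℝ) : ℂ))⁻¹ := by
    have h0 : (Nu 0 0 : ℝ) ≠ 0 := by intro h; rw [h, zero_mul] at hdet; exact zero_ne_one hdet
    have : (Nu 1 1 : ℝ) = (Nu 0 0 : ℝ)⁻¹ := by field_simp; linarith
    rw [this]; push_cast; rfl
  have h0c : ((Nu 0 0 : ℝ) : ℂ) ≠ 0 := by
    intro h; have : (Nu 0 0 : ℝ) = 0 := by exact_mod_cast h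
    rw [this, zero_mul] at hdet; exact zero_ne_one hdet
  rw [coe_sl_smul, hN, h11]
  push_cast
  field_simp
  ring

/-- **Decay of a cusp form at a cusp, through a real matrix**: for `A ∈ SL₂(ℤ)` and upper
triangular `N ∈ SL₂(ℝ)`, `rⁿ ‖φ((A N)(r e^{iθ}))‖ → 0` as `r → ∞` (`θ ∈ (0, π)`): `A N` maps `∞`
to the cusp `A∞`, and `φ|A` decays exponentially. [folklore] -/
theorem tendsto_pow_mul_norm_cusp (f : CuspForm (Gamma0 64) 2) (A : SL(2, ℤ)) (Nu : SL(2, ℝ))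
    (hN : (Nu 1 0 : ℝ) = 0) {θ : ℝ} (hθ : θ ∈ Ioo 0 π) (n : ℕ) :
    Tendsto (fun r : ℝ ↦ r ^ n * ‖f ((((A : SL(2, ℤ)) : SL(2, ℝ)) * Nu) • UpperHalfPlane.ofComplex (polarPt r θ))‖)
      atTop (𝓝 0) := by
  obtain ⟨C, hC0, hC⟩ := HaberlandStokes.exists_norm_apply_le (isCuspFunction_slash f A)
  have hsin : 0 < Real.sin θ := Real.sin_pos_of_pos_of_lt_pi hθ.1 hθ.2
  have hdet := det_entries_real Nu
  rw [hN, mul_zero, sub_zero] at hdet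
  have ha0 : (Nu 0 0 : ℝ) ≠ 0 := by intro h; rw [h, zero_mul] at hdet; exact zero_ne_one hdet
  set a2 : ℝ := (Nu 0 0 : ℝ) ^ 2 with ha2
  have ha2pos : 0 < a2 := by positivity
  set κ : ℝ := 2 * Real.pi / 64 * (a2 * Real.sin θ) with hκ
  have hκpos : 0 < κ := by positivity
  -- sizes of the denominator entries of `A`
  set α : ℝ := |((A 1 0 : ℤ) : ℝ)| * a2 with hα
  set β : ℝ := |((A 1 0 : ℤ) : ℝ)| * |(Nu 0 0 : ℝ) * Nu 0 1| + |((A 1 1 : ℤ) : ℝ)| with hβ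
  have hα0 : 0 ≤ α := by positivity
  have hβ0 : 0 ≤ β := by positivity
  -- the comparison function
  have hlim : Tendsto (fun r : ℝ ↦ C * (α + β) ^ 2 * (r ^ ((n : ℝ) + 2) * Real.exp (-κ * r))) atTop (𝓝 0) := by
    have := (tendsto_rpow_mul_exp_neg_mul_atTop_nhds_zero ((n : ℝ) + 2) κ hκpos).const_mul (C * (α + β) ^ 2)
    rw [mul_zero] at this
    exact this
  refine squeeze_zero' ((eventually_ge_atTop 0).mono fun r hr ↦ by positivity) ?_ hlim
  -- the bound for large `r`
  have hR : ∀ᶠ r : ℝ in atTop, 1 ≤ r ∧ 1 / 2 < a2 * Real.sin θ * r := by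
    refine (eventually_ge_atTop (max 1 (1 / (a2 * Real.sin θ)))).mono fun r hr ↦ ⟨?_, ?_⟩
    · exact (le_max_left _ _).trans hr
    · have h1 : 1 / (a2 * Real.sin θ) ≤ r := (le_max_right _ _).trans hr
      have hpos : 0 < a2 * Real.sin θ := by positivity
      rw [div_le_iff₀ hpos] at h1
      nlinarith
  refine hR.mono fun r ⟨hr1, hr2⟩ ↦ ?_
  have hr0 : 0 < r := by linarith
  set τ : ℍ := UpperHalfPlane.ofComplex (polarPt r θ) with hτ
  have hτc : (τ : ℂ) = polarPt r θ := coe_ofComplex_polarPt hr0 hθ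
  set w : ℍ := Nu • τ with hw
  have hwc : (w : ℂ) = ((Nu 0 0 : ℝ) : ℂ) ^ 2 * polarPt r θ + ((Nu 0 0 : ℝ) : ℂ) * ((Nu 0 1 : ℝ) : ℂ) := by
    rw [hw, coe_upper_smul Nu hN, hτc]
  have hwim : (w : ℂ).im = a2 * Real.sin θ * r := by
    rw [hwc, add_im, mul_im, polarPt_im, polarPt_re]
    simp only [← Complex.ofReal_pow, Complex.ofReal_re, Complex.ofReal_im, mul_im, Complex.ofReal_re,
      Complex.ofReal_im, mul_zero, zero_mul, add_zero]
    rw [ha2]; ring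
  -- `φ(A w) = (φ|A)(w) · (c_A w + d_A)²`
  have hslash := ModularForm.SL_slash_apply (k := (2 : ℤ)) (⇑f) A w
  rw [ModularGroup.denom_apply] at hslash
  have hden : ((A 1 0 : ℤ) : ℂ) * (w : ℂ) + ((A 1 1 : ℤ) : ℂ) ≠ 0 := by
    have := UpperHalfPlane.denom_ne_zero (A : GL (Fin 2) ℝ) w
    rw [ModularGroup.denom_apply] at this
    exact this
  have hfw : f ((((A : SL(2, ℤ)) : SL(2, ℝ)) * Nu) • τ) =
      (⇑f ∣[(2 : ℤ)] A) w * (((A 1 0 : ℤ) : ℂ) * (w : ℂ) + ((A 1 1 : ℤ) : ℂ)) ^ 2 := by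
    rw [mul_smul, show (((A : SL(2, ℤ)) : SL(2, ℝ)) • (Nu • τ)) = A • w from rfl, hslash]
    field_simp
  -- the two bounds
  have hfA : ‖(⇑f ∣[(2 : ℤ)] A) w‖ ≤ C * Real.exp (-(2 * Real.pi / 64) * (w : ℂ).im) := by
    have := hC (w : ℂ) (by rw [hwim]; exact hr2)
    rwa [UpperHalfPlane.ofComplex_apply] at this
  have hdenle : ‖((A 1 0 : ℤ) : ℂ) * (w : ℂ) + ((A 1 1 : ℤ) : ℂ)‖ ≤ (α + β) * r := by
    have hwn : ‖(w : ℂ)‖ ≤ a2 * r + |(Nu 0 0 : ℝ) * Nu 0 1| := by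
      rw [hwc]
      refine (norm_add_le _ _).trans ?_
      rw [norm_mul, ← Complex.ofReal_pow, Complex.norm_real, norm_polarPt, ← Complex.ofReal_mul,
        Complex.norm_real, Real.norm_eq_abs, Real.norm_eq_abs, abs_of_pos ha2pos, abs_of_pos hr0]
    calc ‖((A 1 0 : ℤ) : ℂ) * (w : ℂ) + ((A 1 1 : ℤ) : ℂ)‖
        ≤ ‖((A 1 0 : ℤ) : ℂ)‖ * ‖(w : ℂ)‖ + ‖((A 1 1 : ℤ) : ℂ)‖ := by
          refine (norm_add_le _ _).trans ?_; rw [norm_mul]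
      _ ≤ |((A 1 0 : ℤ) : ℝ)| * (a2 * r + |(Nu 0 0 : ℝ) * Nu 0 1|) + |((A 1 1 : ℤ) : ℝ)| := by
          gcongr
          · rw [← Complex.ofReal_intCast, Complex.norm_real, Real.norm_eq_abs]
          · rw [← Complex.ofReal_intCast, Complex.norm_real, Real.norm_eq_abs]
      _ = α * r + β * 1 := by rw [hα, hβ]; ring
      _ ≤ α * r + β * r := by gcongr
      _ = (α + β) * r := by ring
  -- assemble
  rw [hfw, norm_mul, norm_pow]
  have hexp : Real.exp (-(2 * Real.pi / 64) * (w : ℂ).im) = Real.exp (-κ * r) := by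
    rw [hwim, hκ]; ring_nf
  rw [hexp] at hfA
  have hrpow : r ^ ((n : ℝ) + 2) = r ^ n * r ^ 2 := by
    rw [Real.rpow_add hr0, Real.rpow_natCast, Real.rpow_two]
  rw [hrpow]
  calc r ^ n * (‖(⇑f ∣[(2 : ℤ)] A) w‖ * ‖((A 1 0 : ℤ) : ℂ) * (w : ℂ) + ((A 1 1 : ℤ) : ℂ)‖ ^ 2)
      ≤ r ^ n * ((C * Real.exp (-κ * r)) * ((α + β) * r) ^ 2) := by
        gcongr
    _ = C * (α + β) ^ 2 * (r ^ n * r ^ 2 * Real.exp (-κ * r)) := by ring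

/-! ### Factoring `M = A N` with `A ∈ SL₂(ℤ)`, `N` upper triangular, when `M∞` is a cusp -/

/-- **Bezout factorisation**: if the first column of `M ∈ SL₂(ℝ)` points in a rational direction
`(p : q)` (`p, q` coprime, `M₀₀ q = M₁₀ p`) then `M = A N` with `A = (p u; q v) ∈ SL₂(ℤ)` and
`N = A⁻¹ M` upper triangular. [folklore] -/
theorem exists_sl2z_mul_upper (M : SL(2, ℝ)) {p q : ℤ} (hpq : IsCoprime p q)
    (hdir : (M 0 0 : ℝ) * q = (M 1 0 : ℝ) * p) :
    ∃ (A : SL(2, ℤ)) (Nu : SL(2, ℝ)), (Nu 1 0 : ℝ) = 0 ∧ M = ((A : SL(2, ℤ)) : SL(2, ℝ)) * Nu := by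
  obtain ⟨u, v, huv⟩ := hpq
  have hdetM := det_entries_real M
  -- `u p + v q = 1`; `A = (p, -v; q, u)`, `N = A⁻¹ M = (u, v; -q, p) M`
  let A : SL(2, ℤ) := ⟨!![p, -v; q, u], by rw [Matrix.det_fin_two_of]; linarith⟩
  let Nu : SL(2, ℝ) := ⟨!![(u : ℝ) * M 0 0 + v * M 1 0, (u : ℝ) * M 0 1 + v * M 1 1;
      -(q : ℝ) * M 0 0 + p * M 1 0, -(q : ℝ) * M 0 1 + p * M 1 1], by
    rw [Matrix.det_fin_two_of]
    have huvR : (u : ℝ) * p + v * q = 1 := by exact_mod_cast huv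
    linear_combination ((u : ℝ) * p + v * q) * hdetM + huvR⟩
  refine ⟨A, Nu, ?_, ?_⟩
  · show -(q : ℝ) * M 0 0 + p * M 1 0 = 0
    linarith
  · have huvR : (u : ℝ) * p + v * q = 1 := by exact_mod_cast huv
    ext i j
    have e : ((((A : SL(2, ℤ)) : SL(2, ℝ)) * Nu : SL(2, ℝ)) i j : ℝ) =
        (A i 0 : ℤ) * (Nu 0 j : ℝ) + (A i 1 : ℤ) * (Nu 1 j : ℝ) := by
      simp [Matrix.mul_apply, Fin.sum_univ_two, Matrix.SpecialLinearGroup.map_apply_coe]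
    rw [e]
    fin_cases i <;> fin_cases j
    · show (M 0 0 : ℝ) = ((p : ℤ) : ℝ) * ((u : ℝ) * M 0 0 + v * M 1 0) + ((-v : ℤ) : ℝ) * (-(q : ℝ) * M 0 0 + p * M 1 0)
      push_cast; linear_combination (-(M 0 0 : ℝ)) * huvR
    · show (M 0 1 : ℝ) = ((p : ℤ) : ℝ) * ((u : ℝ) * M 0 1 + v * M 1 1) + ((-v : ℤ) : ℝ) * (-(q : ℝ) * M 0 1 + p * M 1 1)
      push_cast; linear_combination (-(M 0 1 : ℝ)) * huvR
    · show (M 1 0 : ℝ) = ((q : ℤ) : ℝ) * ((u : ℝ) * M 0 0 + v * M 1 0) + ((u : ℤ) : ℝ) * (-(q : ℝ) * M 0 0 + p * M 1 0)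
      linear_combination (-(M 1 0 : ℝ)) * huvR
    · show (M 1 1 : ℝ) = ((q : ℤ) : ℝ) * ((u : ℝ) * M 0 1 + v * M 1 1) + ((u : ℤ) : ℝ) * (-(q : ℝ) * M 0 1 + p * M 1 1)
      linear_combination (-(M 1 1 : ℝ)) * huvR

/-- A real direction `(a : c)` with `a/c` rational or `c = 0` is a coprime integer direction.
[folklore] -/
theorem exists_coprime_direction {a c : ℝ} (hrat : c = 0 ∨ ∃ t : ℚ, a = (t : ℝ) * c) :
    ∃ p q : ℤ, IsCoprime p q ∧ a * q = c * p := by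
  rcases hrat with hc | ⟨t, ht⟩
  · exact ⟨1, 0, isCoprime_one_left, by rw [hc]; simp⟩
  · refine ⟨t.num, t.den, ?_, ?_⟩
    · rw [Int.isCoprime_iff_gcd_eq_one, Int.gcd, Int.natAbs_natCast]
      exact t.reduced
    · have hden : ((t.den : ℤ) : ℝ) ≠ 0 := by exact_mod_cast t.den_ne_zero
      have ht' : (t : ℝ) = ((t.num : ℤ) : ℝ) / ((t.den : ℤ) : ℝ) := by
        rw [Rat.cast_def]; push_cast; rfl
      rw [ht, ht']
      field_simp


/-! ### The columns of `M` are isotropic; for split `k₀` they point to cusps -/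

/-- From `ι♮(k₀) ∘ M = λXY`: the first column of `M` is isotropic. [folklore] -/
theorem isotropic_col0 {x : V} {M : SL(2, ℝ)} {lam : ℝ} (hM : actSL M x = xyForm lam) :
    x 0 * (M 0 0 : ℝ) ^ 2 + x 1 * (M 0 0 : ℝ) * M 1 0 + x 2 * (M 1 0 : ℝ) ^ 2 = 0 := by
  have h := congrFun (congrArg (fun v : V ↦ (v : Fin 3 → ℝ)) hM) 0
  simp [actSL, actV, xyForm] at h
  linarith [h]

/-- From `ι♮(k₀) ∘ M = λXY`: the second column of `M` is isotropic. [folklore] -/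
theorem isotropic_col1 {x : V} {M : SL(2, ℝ)} {lam : ℝ} (hM : actSL M x = xyForm lam) :
    x 0 * (M 0 1 : ℝ) ^ 2 + x 1 * (M 0 1 : ℝ) * M 1 1 + x 2 * (M 1 1 : ℝ) ^ 2 = 0 := by
  have h := congrFun (congrArg (fun v : V ↦ (v : Fin 3 → ℝ)) hM) 2
  simp [actSL, actV, xyForm] at h
  linarith [h]

/-- **Isotropic directions of a split form are rational**: if `Δ(k₀) = m₀² > 0` and
`x₀a² + x₁ac + x₂c² = 0` (`x = ι♮(k₀)`) then `c = 0` or `a/c ∈ ℚ`. [folklore] -/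
theorem isotropic_dir_rational {k₀ : Fin 3 → ℤ} {m₀ : ℤ} (hm₀ : 0 < m₀) (hΔ : intDisc k₀ = m₀ ^ 2)
    {a c : ℝ} (hiso : latSharp k₀ 0 * a ^ 2 + latSharp k₀ 1 * a * c + latSharp k₀ 2 * c ^ 2 = 0) :
    c = 0 ∨ ∃ t : ℚ, a = (t : ℝ) * c := by
  by_cases hc : c = 0
  · exact Or.inl hc
  right
  set t₀ : ℝ := a / c with ht₀
  have hat : a = t₀ * c := by rw [ht₀]; field_simp
  have hquad : latSharp k₀ 0 * t₀ ^ 2 + latSharp k₀ 1 * t₀ + latSharp k₀ 2 = 0 := by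
    have : (latSharp k₀ 0 * t₀ ^ 2 + latSharp k₀ 1 * t₀ + latSharp k₀ 2) * c ^ 2 = 0 := by
      rw [hat] at hiso; linear_combination hiso
    rcases mul_eq_zero.mp this with h | h
    · exact h
    · exact absurd (pow_eq_zero_iff two_ne_zero |>.mp h) hc
  rw [latSharp_zero, latSharp_one, latSharp_two] at hquad
  have hΔR : ((k₀ 1 : ℝ)) ^ 2 - 256 * (k₀ 0 : ℝ) * (k₀ 2 : ℝ) = (m₀ : ℝ) ^ 2 := by
    have : ((intDisc k₀ : ℤ) : ℝ) = ((m₀ ^ 2 : ℤ) : ℝ) := by rw [hΔ]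
    rw [intDisc] at this; push_cast at this; linarith
  by_cases hk0 : k₀ 0 = 0
  · -- linear case
    have hk0R : (k₀ 0 : ℝ) = 0 := by exact_mod_cast hk0
    have hk1 : (k₀ 1 : ℝ) ≠ 0 := by
      intro h1
      rw [hk0R, h1] at hΔR
      have : (m₀ : ℝ) ^ 2 = 0 := by linarith
      have hm : (m₀ : ℝ) = 0 := pow_eq_zero_iff two_ne_zero |>.mp this
      have : (0 : ℝ) < m₀ := by exact_mod_cast hm₀
      linarith
    refine ⟨-(k₀ 2 : ℚ) / (k₀ 1 : ℚ), ?_⟩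
    rw [hat]
    congr 1
    rw [hk0R] at hquad
    have : t₀ = -(k₀ 2 : ℝ) / (k₀ 1 : ℝ) := by
      field_simp
      linarith
    rw [this]; push_cast; ring
  · -- quadratic case: `t₀` is one of the two rational roots
    have hk0R : (k₀ 0 : ℝ) ≠ 0 := by exact_mod_cast hk0
    set r₁ : ℚ := (-(k₀ 1 : ℚ) - m₀) / (128 * k₀ 0) with hr₁
    set r₂ : ℚ := (-(k₀ 1 : ℚ) + m₀) / (128 * k₀ 0) with hr₂
    have hr₁R : ((r₁ : ℚ) : ℝ) = (-(k₀ 1 : ℝ) - m₀) / (128 * k₀ 0) := by rw [hr₁]; push_cast; ring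
    have hr₂R : ((r₂ : ℚ) : ℝ) = (-(k₀ 1 : ℝ) + m₀) / (128 * k₀ 0) := by rw [hr₂]; push_cast; ring
    have hfac : 64 * (k₀ 0 : ℝ) * t₀ ^ 2 + (k₀ 1 : ℝ) * t₀ + (k₀ 2 : ℝ) =
        64 * (k₀ 0 : ℝ) * (t₀ - (r₁ : ℝ)) * (t₀ - (r₂ : ℝ)) := by
      rw [hr₁R, hr₂R]
      field_simp
      linear_combination (-(64:ℝ)) * hΔR
    rw [hfac] at hquad
    rcases mul_eq_zero.mp hquad with h | h
    · rcases mul_eq_zero.mp h with h' | h'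
      · exfalso
        rcases mul_eq_zero.mp h' with h'' | h''
        · norm_num at h''
        · exact hk0R h''
      · exact ⟨r₁, by rw [hat]; congr 1; linarith⟩
    · exact ⟨r₂, by rw [hat]; congr 1; linarith⟩

/-! ### Ray decay of `(φ|M) K · τ` at `∞` and at `0` -/

/-- `‖(φ|M)(τ) K τ‖ = ‖φ(Mτ)‖ · r ‖K‖ / |M₁₀τ + M₁₁|²` on the ray (`r > 0`). [folklore] -/
theorem norm_slashSL_mul_polarPt (f : ℍ → ℂ) (M : SL(2, ℝ)) (K : ℂ) {r θ : ℝ} (hr : 0 < r) :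
    ‖slashSL f M (polarPt r θ) * K * polarPt r θ‖ =
      ‖f (M • UpperHalfPlane.ofComplex (polarPt r θ))‖ * ‖K‖ * r /
        ‖((M 1 0 : ℝ) : ℂ) * polarPt r θ + ((M 1 1 : ℝ) : ℂ)‖ ^ 2 := by
  rw [slashSL, norm_mul, norm_mul, norm_mul, norm_inv, norm_pow, norm_polarPt, abs_of_pos hr]
  ring

/-- Lower bound for the denominator on rays: `|M₁₀ τ + M₁₁| ≥ |M₁₀| r sin θ` and, if `M₁₀ = 0`,
`= |M₁₁| > 0`. For `r ≥ 1` this gives a uniform bound `1/|M₁₀τ + M₁₁|² ≤ B`. [folklore] -/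
theorem exists_inv_denom_sq_le_atTop (M : SL(2, ℝ)) {θ : ℝ} (hθ : θ ∈ Ioo 0 π) :
    ∃ B : ℝ, 0 ≤ B ∧ ∀ r : ℝ, 1 ≤ r →
      1 / ‖((M 1 0 : ℝ) : ℂ) * polarPt r θ + ((M 1 1 : ℝ) : ℂ)‖ ^ 2 ≤ B := by
  have hsin : 0 < Real.sin θ := Real.sin_pos_of_pos_of_lt_pi hθ.1 hθ.2
  by_cases h10 : (M 1 0 : ℝ) = 0
  · have hdet := det_entries_real M
    rw [h10, mul_zero, sub_zero] at hdet
    have h11 : (M 1 1 : ℝ) ≠ 0 := by intro h; rw [h, mul_zero] at hdet; exact zero_ne_one hdet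
    refine ⟨1 / (M 1 1 : ℝ) ^ 2, by positivity, fun r _ ↦ ?_⟩
    rw [h10]; push_cast; rw [zero_mul, zero_add, Complex.norm_real, Real.norm_eq_abs, sq_abs]
  · refine ⟨1 / ((M 1 0 : ℝ) * Real.sin θ) ^ 2, by positivity, fun r hr ↦ ?_⟩
    have him : (((M 1 0 : ℝ) : ℂ) * polarPt r θ + ((M 1 1 : ℝ) : ℂ)).im = (M 1 0 : ℝ) * (r * Real.sin θ) := by
      simp [mul_im, polarPt_im, polarPt_re]
    have hge : |(M 1 0 : ℝ)| * Real.sin θ ≤ ‖((M 1 0 : ℝ) : ℂ) * polarPt r θ + ((M 1 1 : ℝ) : ℂ)‖ := by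
      calc |(M 1 0 : ℝ)| * Real.sin θ ≤ |(M 1 0 : ℝ)| * (r * Real.sin θ) := by
            rw [← mul_assoc]; gcongr; nlinarith [abs_nonneg (M 1 0 : ℝ)]
        _ = |(((M 1 0 : ℝ) : ℂ) * polarPt r θ + ((M 1 1 : ℝ) : ℂ)).im| := by
            rw [him, abs_mul, abs_of_pos (by positivity : 0 < r * Real.sin θ)]
        _ ≤ _ := Complex.abs_im_le_norm _
    have hpos : 0 < |(M 1 0 : ℝ)| * Real.sin θ := by positivity
    rw [show ((M 1 0 : ℝ) * Real.sin θ) ^ 2 = (|(M 1 0 : ℝ)| * Real.sin θ) ^ 2 by rw [mul_pow, mul_pow, sq_abs]]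
    gcongr

/-- **Decay at `∞` along rays**: `(φ|M)(τ) K τ → 0` as `|τ| → ∞` when `M∞` is a cusp
(`M = A N`, `A ∈ SL₂(ℤ)`, `N` upper triangular). [folklore] -/
theorem tendsto_slashSL_mul_atTop (f : CuspForm (Gamma0 64) 2) {M : SL(2, ℝ)} {A : SL(2, ℤ)} {Nu : SL(2, ℝ)}
    (hN : (Nu 1 0 : ℝ) = 0) (hMfac : M = ((A : SL(2, ℤ)) : SL(2, ℝ)) * Nu) (K : ℂ) {θ : ℝ} (hθ : θ ∈ Ioo 0 π) :
    Tendsto (fun r : ℝ ↦ slashSL f M (polarPt r θ) * K * polarPt r θ) atTop (𝓝 0) := by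
  obtain ⟨B, hB0, hB⟩ := exists_inv_denom_sq_le_atTop M hθ
  have hdec := tendsto_pow_mul_norm_cusp f A Nu hN hθ 1
  rw [← hMfac] at hdec
  rw [tendsto_zero_iff_norm_tendsto_zero]
  refine squeeze_zero' ((eventually_ge_atTop 1).mono fun r _ ↦ norm_nonneg _)
    ((eventually_ge_atTop 1).mono fun r hr ↦ ?_) (by simpa using hdec.mul_const (‖K‖ * B))
  have hr0 : 0 < r := by linarith
  rw [norm_slashSL_mul_polarPt _ M K hr0]
  have hf0 : 0 ≤ ‖f (M • UpperHalfPlane.ofComplex (polarPt r θ))‖ := norm_nonneg _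
  calc ‖f (M • UpperHalfPlane.ofComplex (polarPt r θ))‖ * ‖K‖ * r /
        ‖((M 1 0 : ℝ) : ℂ) * polarPt r θ + ((M 1 1 : ℝ) : ℂ)‖ ^ 2
      = r * ‖f (M • UpperHalfPlane.ofComplex (polarPt r θ))‖ * ‖K‖ *
          (1 / ‖((M 1 0 : ℝ) : ℂ) * polarPt r θ + ((M 1 1 : ℝ) : ℂ)‖ ^ 2) := by ring
    _ ≤ r * ‖f (M • UpperHalfPlane.ofComplex (polarPt r θ))‖ * ‖K‖ * B := by
        gcongr
        exact hB r hr
    _ = r * ‖f (M • UpperHalfPlane.ofComplex (polarPt r θ))‖ * (‖K‖ * B) := by ring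

/-- `-(r e^{iθ}) · (r⁻¹ e^{i(π-θ)}) = 1`. [folklore] -/
theorem neg_polarPt_mul_polarPt_inv {r : ℝ} (hr : r ≠ 0) (θ : ℝ) :
    -polarPt r θ * polarPt r⁻¹ (π - θ) = 1 := by
  have hcs : (Real.cos θ : ℂ) ^ 2 + (Real.sin θ : ℂ) ^ 2 = 1 := by
    have := Real.cos_sq_add_sin_sq θ
    exact_mod_cast this
  simp only [polarPt, Real.cos_pi_sub, Real.sin_pi_sub, Complex.ofReal_neg, Complex.ofReal_inv]
  have hr' : (r : ℂ) ≠ 0 := Complex.ofReal_ne_zero.mpr hr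
  field_simp
  linear_combination hcs + (-(Real.sin θ : ℂ) ^ 2) * Complex.I_sq

/-- **`S` on rays**: `S • (r e^{iθ}) = r⁻¹ e^{i(π-θ)}` (`r > 0`, `θ ∈ (0, π)`). [folklore] -/
theorem S_smul_ofComplex_polarPt {r θ : ℝ} (hr : 0 < r) (hθ : θ ∈ Ioo 0 π) :
    ModularGroup.S • UpperHalfPlane.ofComplex (polarPt r θ) = UpperHalfPlane.ofComplex (polarPt r⁻¹ (π - θ)) := by
  have hθ' : π - θ ∈ Ioo 0 π := ⟨by linarith [hθ.2], by linarith [hθ.1]⟩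
  apply UpperHalfPlane.ext
  rw [coe_S_smul, coe_ofComplex_polarPt hr hθ, coe_ofComplex_polarPt (inv_pos.mpr hr) hθ']
  exact inv_eq_of_mul_eq_one_right (neg_polarPt_mul_polarPt_inv hr.ne' θ)

/-- Near `0` on a ray: `r/|M₁₀τ + M₁₁|² ≤ B r⁻¹` for small `r > 0`. [folklore] -/
theorem exists_denom_bound_nhds_zero (M : SL(2, ℝ)) (θ : ℝ) :
    ∃ B r₀ : ℝ, 0 ≤ B ∧ 0 < r₀ ∧ ∀ r : ℝ, 0 < r → r < r₀ →
      r / ‖((M 1 0 : ℝ) : ℂ) * polarPt r θ + ((M 1 1 : ℝ) : ℂ)‖ ^ 2 ≤ B * r⁻¹ := by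
  by_cases h11 : (M 1 1 : ℝ) = 0
  · have hdet := det_entries_real M
    rw [h11, mul_zero, zero_sub] at hdet
    have h10 : (M 1 0 : ℝ) ≠ 0 := by intro h; rw [h, mul_zero, neg_zero] at hdet; exact zero_ne_one hdet
    refine ⟨1 / (M 1 0 : ℝ) ^ 2, 1, by positivity, one_pos, fun r hr _ ↦ ?_⟩
    rw [h11, Complex.ofReal_zero, add_zero, norm_mul, Complex.norm_real, norm_polarPt, Real.norm_eq_abs,
      abs_of_pos hr, mul_pow, sq_abs]
    field_simp
    rfl
  · set r₀ : ℝ := min 1 (|(M 1 1 : ℝ)| / (2 * (|(M 1 0 : ℝ)| + 1))) with hr₀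
    have h11pos : 0 < |(M 1 1 : ℝ)| := abs_pos.mpr h11
    have hr₀pos : 0 < r₀ := lt_min one_pos (by positivity)
    refine ⟨4 / (M 1 1 : ℝ) ^ 2, r₀, by positivity, hr₀pos, fun r hr hrr ↦ ?_⟩
    have hr1 : r < 1 := hrr.trans_le (min_le_left _ _)
    have hr2 : r < |(M 1 1 : ℝ)| / (2 * (|(M 1 0 : ℝ)| + 1)) := hrr.trans_le (min_le_right _ _)
    -- `|M₁₀ τ + M₁₁| ≥ |M₁₁| - |M₁₀| r ≥ |M₁₁|/2`
    have hlow : |(M 1 1 : ℝ)| / 2 ≤ ‖((M 1 0 : ℝ) : ℂ) * polarPt r θ + ((M 1 1 : ℝ) : ℂ)‖ := by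
      have h1 : ‖((M 1 1 : ℝ) : ℂ)‖ - ‖((M 1 0 : ℝ) : ℂ) * polarPt r θ‖ ≤
          ‖((M 1 0 : ℝ) : ℂ) * polarPt r θ + ((M 1 1 : ℝ) : ℂ)‖ := by
        have := norm_sub_norm_le (((M 1 1 : ℝ) : ℂ)) (-(((M 1 0 : ℝ) : ℂ) * polarPt r θ))
        rw [norm_neg, sub_neg_eq_add, add_comm] at this
        exact this
      rw [Complex.norm_real, norm_mul, Complex.norm_real, norm_polarPt, Real.norm_eq_abs, Real.norm_eq_abs,
        abs_of_pos hr] at h1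
      have h2 : |(M 1 0 : ℝ)| * r ≤ |(M 1 1 : ℝ)| / 2 := by
        have hpos : 0 < 2 * (|(M 1 0 : ℝ)| + 1) := by positivity
        rw [lt_div_iff₀ hpos] at hr2
        nlinarith [abs_nonneg (M 1 0 : ℝ), hr.le]
      linarith
    have hpos2 : 0 < |(M 1 1 : ℝ)| / 2 := by positivity
    have hsq : (|(M 1 1 : ℝ)| / 2) ^ 2 ≤ ‖((M 1 0 : ℝ) : ℂ) * polarPt r θ + ((M 1 1 : ℝ) : ℂ)‖ ^ 2 := by
      gcongr
    have hden_pos : 0 < ‖((M 1 0 : ℝ) : ℂ) * polarPt r θ + ((M 1 1 : ℝ) : ℂ)‖ ^ 2 := lt_of_lt_of_le (by positivity) hsq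
    rw [div_le_iff₀ hden_pos]
    have hrr1 : r * r ≤ 1 := by nlinarith
    calc r = r * r * r⁻¹ := by field_simp
      _ ≤ 1 * r⁻¹ := by gcongr
      _ = 4 / (M 1 1 : ℝ) ^ 2 * r⁻¹ * (|(M 1 1 : ℝ)| / 2) ^ 2 := by
          field_simp; rw [sq_abs]; ring
      _ ≤ 4 / (M 1 1 : ℝ) ^ 2 * r⁻¹ * ‖((M 1 0 : ℝ) : ℂ) * polarPt r θ + ((M 1 1 : ℝ) : ℂ)‖ ^ 2 := by
          gcongr

/-- **Decay at `0` along rays**: `(φ|M)(τ) K τ → 0` as `|τ| → 0⁺` when `M0` is a cusp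
(`M S⁻¹ = A' N'`). [folklore] -/
theorem tendsto_slashSL_mul_nhdsGT_zero (f : CuspForm (Gamma0 64) 2) {M : SL(2, ℝ)} {A' : SL(2, ℤ)}
    {Nu' : SL(2, ℝ)} (hN' : (Nu' 1 0 : ℝ) = 0)
    (hPfac : M * (((ModularGroup.S : SL(2, ℤ)) : SL(2, ℝ)))⁻¹ = ((A' : SL(2, ℤ)) : SL(2, ℝ)) * Nu') (K : ℂ)
    {θ : ℝ} (hθ : θ ∈ Ioo 0 π) :
    Tendsto (fun r : ℝ ↦ slashSL f M (polarPt r θ) * K * polarPt r θ) (𝓝[>] 0) (𝓝 0) := by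
  have hθ' : π - θ ∈ Ioo 0 π := ⟨by linarith [hθ.2], by linarith [hθ.1]⟩
  obtain ⟨B, r₀, hB0, hr₀, hB⟩ := exists_denom_bound_nhds_zero M θ
  have hdec := (tendsto_pow_mul_norm_cusp f A' Nu' hN' hθ' 1).comp tendsto_inv_nhdsGT_zero
  rw [← hPfac] at hdec
  -- the point identity `M τ = (M S⁻¹)(S τ)`
  have hpt : ∀ r : ℝ, 0 < r → M • UpperHalfPlane.ofComplex (polarPt r θ) =
      (M * (((ModularGroup.S : SL(2, ℤ)) : SL(2, ℝ)))⁻¹) • UpperHalfPlane.ofComplex (polarPt r⁻¹ (π - θ)) := by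
    intro r hr
    rw [← S_smul_ofComplex_polarPt hr hθ, mul_smul,
      show ModularGroup.S • UpperHalfPlane.ofComplex (polarPt r θ) =
        (((ModularGroup.S : SL(2, ℤ)) : SL(2, ℝ))) • UpperHalfPlane.ofComplex (polarPt r θ) from rfl,
      inv_smul_smul]
  rw [tendsto_zero_iff_norm_tendsto_zero]
  have hev : ∀ᶠ r : ℝ in 𝓝[>] 0, 0 < r ∧ r < r₀ := by
    filter_upwards [Ioo_mem_nhdsGT hr₀] with r hr using hr
  refine squeeze_zero' (hev.mono fun r _ ↦ norm_nonneg _) (hev.mono fun r ⟨hr, hrr⟩ ↦ ?_)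
    (by simpa using hdec.mul_const (‖K‖ * B))
  rw [norm_slashSL_mul_polarPt _ M K hr, hpt r hr]
  set F := ‖f ((M * (((ModularGroup.S : SL(2, ℤ)) : SL(2, ℝ)))⁻¹) • UpperHalfPlane.ofComplex (polarPt r⁻¹ (π - θ)))‖
  have hF : 0 ≤ F := norm_nonneg _
  calc F * ‖K‖ * r / ‖((M 1 0 : ℝ) : ℂ) * polarPt r θ + ((M 1 1 : ℝ) : ℂ)‖ ^ 2
      = F * ‖K‖ * (r / ‖((M 1 0 : ℝ) : ℂ) * polarPt r θ + ((M 1 1 : ℝ) : ℂ)‖ ^ 2) := by ring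
    _ ≤ F * ‖K‖ * (B * r⁻¹) := by gcongr; exact hB r hr hrr
    _ = r⁻¹ * F * (‖K‖ * B) := by ring

/-! ### Integrability of the polar integrand from integrability on the plane -/

/-- **Polar transfer of integrability**: if `planeIntegrand ψ c` is integrable on `{Im > 0}` and
`ψ` is continuous there, then `polarIntegrand ψ c` is integrable on `(0, ∞) × (0, π)`. [folklore] -/
theorem integrableOn_polarIntegrand_of_plane {ψ : ℂ → ℂ} {c : ℝ} (hcont : ContinuousOn ψ {w | 0 < w.im})
    (hint : IntegrableOn (planeIntegrand ψ c) {w : ℂ | 0 < w.im}) :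
    IntegrableOn (polarIntegrand ψ c) (Ioi (0 : ℝ) ×ˢ Ioo 0 π) := by
  have hmeas : MeasurableSet (Ioi (0 : ℝ) ×ˢ Ioo (0 : ℝ) π) := measurableSet_Ioi.prod measurableSet_Ioo
  refine ⟨(continuousOn_polarIntegrand hcont c).aestronglyMeasurable hmeas, ?_⟩
  rw [hasFiniteIntegral_iff_enorm]
  -- compare with the polar-coordinates formula for `‖planeIntegrand‖ₑ · 1_{Im > 0}`
  set F : ℂ → ℝ≥0∞ := fun w ↦ {w : ℂ | 0 < w.im}.indicator (fun w ↦ ‖planeIntegrand ψ c w‖ₑ) w with hF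
  have hpol := Complex.lintegral_comp_polarCoord_symm F
  have hfin : ∫⁻ w, F w < ∞ := by
    rw [hF, lintegral_indicator (measurableSet_lt measurable_const Complex.measurable_im)]
    exact hint.2
  have hsub : Ioi (0 : ℝ) ×ˢ Ioo (0 : ℝ) π ⊆ polarCoord.target := by
    rw [polarCoord_target]
    exact prod_mono Subset.rfl (Ioo_subset_Ioo (by linarith [pi_pos]) le_rfl)
  calc ∫⁻ p in Ioi (0 : ℝ) ×ˢ Ioo 0 π, ‖polarIntegrand ψ c p‖ₑ
      = ∫⁻ p in Ioi (0 : ℝ) ×ˢ Ioo 0 π, ENNReal.ofReal p.1 • F (Complex.polarCoord.symm p) := by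
        refine setLIntegral_congr_fun hmeas fun p hp ↦ ?_
        rw [mem_prod, mem_Ioi, mem_Ioo] at hp
        have hsin : 0 < Real.sin p.2 := Real.sin_pos_of_pos_of_lt_pi hp.2.1 hp.2.2
        have him : 0 < (polarPt p.1 p.2).im := by rw [polarPt_im]; exact mul_pos hp.1 hsin
        rw [hF, polarCoord_symm_eq_polarPt]
        simp only [indicator_of_mem (show polarPt p.1 p.2 ∈ {w : ℂ | 0 < w.im} from him)]
        rw [← smul_planeIntegrand_polarPt ψ c hp.1 hsin.ne', enorm_smul, Real.enorm_eq_ofReal hp.1.le]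
        rfl
    _ ≤ ∫⁻ p in polarCoord.target, ENNReal.ofReal p.1 • F (Complex.polarCoord.symm p) :=
        lintegral_mono_set hsub
    _ = ∫⁻ w, F w := hpol
    _ < ∞ := hfin

/-! ### Integrability along rays -/

/-- The ray function `r ↦ (φ|M)(r e^{iθ}) K e^{iθ}` is continuous on `(0, ∞)`. [folklore] -/
theorem continuousOn_ray (f : CuspForm (Gamma0 64) 2) (M : SL(2, ℝ)) (K : ℂ) {θ : ℝ} (hθ : θ ∈ Ioo 0 π) :
    ContinuousOn (fun r : ℝ ↦ slashSL f M (polarPt r θ) * K * unitAt θ) (Ioi 0) := by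
  have hsin : 0 < Real.sin θ := Real.sin_pos_of_pos_of_lt_pi hθ.1 hθ.2
  have hpt : Continuous fun r : ℝ ↦ polarPt r θ := by unfold polarPt; fun_prop
  have hmaps : MapsTo (fun r : ℝ ↦ polarPt r θ) (Ioi 0) {w : ℂ | 0 < w.im} := by
    intro r hr; show 0 < (polarPt r θ).im; rw [polarPt_im]; exact mul_pos hr hsin
  have h1 : ContinuousOn (fun r : ℝ ↦ slashSL f M (polarPt r θ)) (Ioi 0) :=
    (differentiableOn_slashSL f M).continuousOn.comp hpt.continuousOn hmaps
  exact (h1.mul continuousOn_const).mul continuousOn_const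

/-- `‖(φ|M)(τ) K e^{iθ}‖ = ‖φ(Mτ)‖ ‖K‖ / |M₁₀τ + M₁₁|²` on the ray. [folklore] -/
theorem norm_ray (f : ℍ → ℂ) (M : SL(2, ℝ)) (K : ℂ) (r θ : ℝ) :
    ‖slashSL f M (polarPt r θ) * K * unitAt θ‖ =
      ‖f (M • UpperHalfPlane.ofComplex (polarPt r θ))‖ * ‖K‖ /
        ‖((M 1 0 : ℝ) : ℂ) * polarPt r θ + ((M 1 1 : ℝ) : ℂ)‖ ^ 2 := by
  rw [slashSL, norm_mul, norm_mul, norm_mul, norm_inv, norm_pow, norm_unitAt]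
  ring

/-- **Integrability along rays** for `(φ|M) K` when both `M∞` and `M0` are cusps. [folklore] -/
theorem integrableOn_ray (f : CuspForm (Gamma0 64) 2) {M : SL(2, ℝ)} {A A' : SL(2, ℤ)} {Nu Nu' : SL(2, ℝ)}
    (hN : (Nu 1 0 : ℝ) = 0) (hMfac : M = ((A : SL(2, ℤ)) : SL(2, ℝ)) * Nu)
    (hN' : (Nu' 1 0 : ℝ) = 0)
    (hPfac : M * (((ModularGroup.S : SL(2, ℤ)) : SL(2, ℝ)))⁻¹ = ((A' : SL(2, ℤ)) : SL(2, ℝ)) * Nu')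
    (K : ℂ) {θ : ℝ} (hθ : θ ∈ Ioo 0 π) :
    IntegrableOn (fun r : ℝ ↦ slashSL f M (polarPt r θ) * K * unitAt θ) (Ioi 0) := by
  have hθ' : π - θ ∈ Ioo 0 π := ⟨by linarith [hθ.2], by linarith [hθ.1]⟩
  have hcont := continuousOn_ray f M K hθ
  -- tail: `r³ ‖φ(M τ_r)‖ ≤ 1` for `r ≥ R ≥ 1`, and `1/|den|² ≤ B`
  obtain ⟨B, hB0, hB⟩ := exists_inv_denom_sq_le_atTop M hθ
  have hdec := tendsto_pow_mul_norm_cusp f A Nu hN hθ 3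
  rw [← hMfac] at hdec
  have hevT := (hdec.eventually (ge_mem_nhds (show (0:ℝ) < 1 by norm_num)))
  rw [Filter.eventually_atTop] at hevT
  obtain ⟨R₀, hR₀⟩ := hevT
  set R : ℝ := max R₀ 1 with hR
  have hR1 : 1 ≤ R := le_max_right _ _
  -- head: `‖φ(M τ_r)‖ ≤ r²` for `0 < r < r₁`, and `r/|den|² ≤ B' r⁻¹`
  obtain ⟨B', r₀, hB'0, hr₀, hB'⟩ := exists_denom_bound_nhds_zero M θ
  have hdec0 := (tendsto_pow_mul_norm_cusp f A' Nu' hN' hθ' 2).comp tendsto_inv_nhdsGT_zero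
  rw [← hPfac] at hdec0
  have hev0 := hdec0.eventually (ge_mem_nhds (show (0:ℝ) < 1 by norm_num))
  obtain ⟨r₁', hr₁'pos, hr₁'⟩ := (nhdsGT_basis (0 : ℝ)).eventually_iff.mp hev0
  set r₁ : ℝ := min (min (r₁' / 2) (r₀ / 2)) R with hr₁def
  have hr₁pos : 0 < r₁ := lt_min (lt_min (by linarith) (by linarith)) (by linarith)
  have hr₁R : r₁ ≤ R := min_le_right _ _
  have hr₁a : r₁ < r₁' := by
    have : r₁ ≤ r₁' / 2 := (min_le_left _ _).trans (min_le_left _ _)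
    linarith
  have hr₁b : r₁ < r₀ := by
    have : r₁ ≤ r₀ / 2 := (min_le_left _ _).trans (min_le_right _ _)
    linarith
  have hpt : ∀ r : ℝ, 0 < r → M • UpperHalfPlane.ofComplex (polarPt r θ) =
      (M * (((ModularGroup.S : SL(2, ℤ)) : SL(2, ℝ)))⁻¹) • UpperHalfPlane.ofComplex (polarPt r⁻¹ (π - θ)) := by
    intro r hr
    rw [← S_smul_ofComplex_polarPt hr hθ, mul_smul,
      show ModularGroup.S • UpperHalfPlane.ofComplex (polarPt r θ) =
        (((ModularGroup.S : SL(2, ℤ)) : SL(2, ℝ))) • UpperHalfPlane.ofComplex (polarPt r θ) from rfl,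
      inv_smul_smul]
  -- decomposition `(0, ∞) = (0, r₁] ∪ [r₁, R] ∪ (R, ∞)`
  have hunion : Ioi (0 : ℝ) = (Ioc 0 r₁ ∪ Icc r₁ R) ∪ Ioi R := by
    rw [Ioc_union_Icc_eq_Ioc hr₁pos hr₁R, Ioc_union_Ioi_eq_Ioi (by linarith)]
  rw [hunion]
  refine IntegrableOn.union (IntegrableOn.union ?_ ?_) ?_
  · -- bounded on `(0, r₁]`
    refine ⟨(hcont.mono Ioc_subset_Ioi_self).aestronglyMeasurable measurableSet_Ioc,
      HasFiniteIntegral.of_bounded (C := ‖K‖ * B') ?_⟩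
    rw [ae_restrict_iff' measurableSet_Ioc]
    refine Eventually.of_forall fun r hr ↦ ?_
    have hr0 : 0 < r := hr.1
    have hrr₀ : r < r₀ := lt_of_le_of_lt hr.2 hr₁b
    have hrr₁' : r ∈ Ioo 0 r₁' := ⟨hr0, lt_of_le_of_lt hr.2 hr₁a⟩
    have hf2 : ‖f (M • UpperHalfPlane.ofComplex (polarPt r θ))‖ ≤ r ^ 2 := by
      have h := hr₁' hrr₁'
      simp only [Function.comp_apply] at h
      rw [hpt r hr0]
      have hr2 : 0 < r ^ 2 := by positivity
      have : (r⁻¹) ^ 2 * ‖f ((M * (((ModularGroup.S : SL(2, ℤ)) : SL(2, ℝ)))⁻¹) •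
          UpperHalfPlane.ofComplex (polarPt r⁻¹ (π - θ)))‖ * r ^ 2 ≤ 1 * r ^ 2 :=
        mul_le_mul_of_nonneg_right h hr2.le
      rwa [one_mul, mul_comm, ← mul_assoc, inv_pow, mul_inv_cancel₀ hr2.ne', one_mul] at this
    rw [norm_ray]
    have hden := hB' r hr0 hrr₀
    have hdenpos : 0 < ‖((M 1 0 : ℝ) : ℂ) * polarPt r θ + ((M 1 1 : ℝ) : ℂ)‖ ^ 2 := by
      have := sl_denom_ne_zero_real M (UpperHalfPlane.ofComplex (polarPt r θ))
      rw [coe_ofComplex_polarPt hr0 hθ] at this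
      positivity
    calc ‖f (M • UpperHalfPlane.ofComplex (polarPt r θ))‖ * ‖K‖ /
          ‖((M 1 0 : ℝ) : ℂ) * polarPt r θ + ((M 1 1 : ℝ) : ℂ)‖ ^ 2
        ≤ r ^ 2 * ‖K‖ / ‖((M 1 0 : ℝ) : ℂ) * polarPt r θ + ((M 1 1 : ℝ) : ℂ)‖ ^ 2 := by gcongr
      _ = ‖K‖ * r * (r / ‖((M 1 0 : ℝ) : ℂ) * polarPt r θ + ((M 1 1 : ℝ) : ℂ)‖ ^ 2) := by ring
      _ ≤ ‖K‖ * r * (B' * r⁻¹) := by gcongr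
      _ = ‖K‖ * B' := by field_simp
  · exact (hcont.mono (Icc_subset_Ioi_iff hr₁R |>.mpr hr₁pos)).integrableOn_Icc
  · -- tail `(R, ∞)`: `‖·‖ ≤ ‖K‖ B r⁻³`
    have hRpos : 0 < R := by linarith
    have hg0 : IntegrableOn (fun r : ℝ ↦ r ^ (-3 : ℝ)) (Ioi R) := integrableOn_Ioi_rpow_of_lt (by norm_num) hRpos
    have hg : IntegrableOn (fun r : ℝ ↦ ‖K‖ * B * (r ^ 3)⁻¹) (Ioi R) := by
      refine (hg0.congr_fun (fun r hr ↦ ?_) measurableSet_Ioi).const_mul (‖K‖ * B)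
      have hr0 : 0 < r := hRpos.trans hr
      rw [Real.rpow_neg hr0.le, show (3 : ℝ) = ((3 : ℕ) : ℝ) by norm_num, Real.rpow_natCast]
    refine Integrable.mono' hg ((hcont.mono (Ioi_subset_Ioi hRpos.le)).aestronglyMeasurable measurableSet_Ioi) ?_
    rw [ae_restrict_iff' measurableSet_Ioi]
    refine Eventually.of_forall fun r hr ↦ ?_
    have hrR : R < r := hr
    have hr1 : 1 ≤ r := hR1.trans hrR.le
    have hr0 : 0 < r := by linarith
    have hr3 : 0 < r ^ 3 := by positivity
    have hf3 : ‖f (M • UpperHalfPlane.ofComplex (polarPt r θ))‖ ≤ (r ^ 3)⁻¹ := by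
      have h := hR₀ r ((le_max_left _ _).trans hrR.le)
      have e : ‖f (M • UpperHalfPlane.ofComplex (polarPt r θ))‖ =
          (r ^ 3 * ‖f (M • UpperHalfPlane.ofComplex (polarPt r θ))‖) * (r ^ 3)⁻¹ := by
        field_simp
      rw [e]
      calc (r ^ 3 * ‖f (M • UpperHalfPlane.ofComplex (polarPt r θ))‖) * (r ^ 3)⁻¹
          ≤ 1 * (r ^ 3)⁻¹ := by gcongr
        _ = (r ^ 3)⁻¹ := one_mul _
    rw [norm_ray]
    have hden := hB r hr1
    calc ‖f (M • UpperHalfPlane.ofComplex (polarPt r θ))‖ * ‖K‖ /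
          ‖((M 1 0 : ℝ) : ℂ) * polarPt r θ + ((M 1 1 : ℝ) : ℂ)‖ ^ 2
        = ‖f (M • UpperHalfPlane.ofComplex (polarPt r θ))‖ * ‖K‖ *
            (1 / ‖((M 1 0 : ℝ) : ℂ) * polarPt r θ + ((M 1 1 : ℝ) : ℂ)‖ ^ 2) := by ring
      _ ≤ (r ^ 3)⁻¹ * ‖K‖ * B := by gcongr
      _ = ‖K‖ * B * (r ^ 3)⁻¹ := by ring

/-! ### The two factorizations for a split vector -/

/-- The first column of `M S⁻¹` is `-(M₀₁, M₁₁)`. [folklore] -/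
theorem mul_S_inv_col (M : SL(2, ℝ)) :
    ((M * (((ModularGroup.S : SL(2, ℤ)) : SL(2, ℝ)))⁻¹ : SL(2, ℝ)) 0 0 : ℝ) = -(M 0 1 : ℝ) ∧
    ((M * (((ModularGroup.S : SL(2, ℤ)) : SL(2, ℝ)))⁻¹ : SL(2, ℝ)) 1 0 : ℝ) = -(M 1 1 : ℝ) := by
  set Sinv : SL(2, ℝ) := (((ModularGroup.S : SL(2, ℤ)) : SL(2, ℝ)))⁻¹ with hSinv
  have hS : (Sinv : Matrix (Fin 2) (Fin 2) ℝ) = !![(0 : ℝ), 1; -1, 0] := by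
    rw [hSinv, Matrix.SpecialLinearGroup.coe_inv, Matrix.adjugate_fin_two]
    ext i j
    fin_cases i <;> fin_cases j <;> simp [ModularGroup.S, Matrix.SpecialLinearGroup.map_apply_coe]
  have h00 : (Sinv 0 0 : ℝ) = 0 := by
    rw [show (Sinv 0 0 : ℝ) = (Sinv : Matrix (Fin 2) (Fin 2) ℝ) 0 0 from rfl, hS]; rfl
  have h10 : (Sinv 1 0 : ℝ) = -1 := by
    rw [show (Sinv 1 0 : ℝ) = (Sinv : Matrix (Fin 2) (Fin 2) ℝ) 1 0 from rfl, hS]; rfl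
  have e : ∀ i, ((M * Sinv : SL(2, ℝ)) i 0 : ℝ) = M i 0 * Sinv 0 0 + M i 1 * Sinv 1 0 := by
    intro i
    simp [Matrix.mul_apply, Fin.sum_univ_two]
  rw [e 0, e 1, h00, h10]
  constructor <;> ring

/-- **Both `M∞` and `M0` are cusps for a split vector**: the factorizations `M = A N` and
`M S⁻¹ = A' N'` (`A, A' ∈ SL₂(ℤ)`, `N, N'` upper triangular). [folklore] -/
theorem exists_factorizations_of_sq {k₀ : Fin 3 → ℤ} {m₀ : ℤ} (hm₀ : 0 < m₀) (hΔ : intDisc k₀ = m₀ ^ 2)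
    {M : SL(2, ℝ)} {lam : ℝ} (hM : actSL M (latSharp k₀) = xyForm lam) :
    (∃ (A : SL(2, ℤ)) (Nu : SL(2, ℝ)), (Nu 1 0 : ℝ) = 0 ∧ M = ((A : SL(2, ℤ)) : SL(2, ℝ)) * Nu) ∧
    (∃ (A' : SL(2, ℤ)) (Nu' : SL(2, ℝ)), (Nu' 1 0 : ℝ) = 0 ∧
      M * (((ModularGroup.S : SL(2, ℤ)) : SL(2, ℝ)))⁻¹ = ((A' : SL(2, ℤ)) : SL(2, ℝ)) * Nu') := by
  constructor
  · have hiso := isotropic_col0 hM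
    have hrat := isotropic_dir_rational hm₀ hΔ (a := (M 0 0 : ℝ)) (c := (M 1 0 : ℝ)) (by linear_combination hiso)
    obtain ⟨p, q, hpq, hdir⟩ := exists_coprime_direction hrat
    exact exists_sl2z_mul_upper M hpq hdir
  · have hiso := isotropic_col1 hM
    obtain ⟨h00, h10⟩ := mul_S_inv_col M
    have hrat := isotropic_dir_rational hm₀ hΔ (a := -(M 0 1 : ℝ)) (c := -(M 1 1 : ℝ)) (by linear_combination hiso)
    obtain ⟨p, q, hpq, hdir⟩ := exists_coprime_direction hrat
    refine exists_sl2z_mul_upper _ hpq ?_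
    rw [h00, h10]; exact hdir

/-! ### The split orbit integral -/

variable (D : ℕ) [NeZero D]

/-- `{Im > 0} = sectorSet (0, ∞)`. [folklore] -/
theorem setOf_im_pos_eq_sectorSet : {w : ℂ | 0 < w.im} = sectorSet (Ioi 0) := by
  ext w
  simp only [sectorSet, mem_setOf_eq, mem_Ioi, norm_pos_iff]
  constructor
  · intro h; exact ⟨h, fun h0 ↦ by rw [h0] at h; simp at h⟩
  · exact fun h ↦ h.1

/-- **The orbit integral of a split indefinite vector** (`D` odd, `φ ∈ S₂(Γ₀(64))`): for `ω` with
`Δ(k_ω) = m₀² > 0` (a form with rational roots, i.e. a pair of cusps), with `M ∈ SL₂(ℝ)` moving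
the roots to `∞, 0` (`ι♮(k_ω) ∘ M = λXY`),
`J(ω) = c_D(k_ω) λ e(λ²Z) · (∫₀^∞ (φ|M)(iy) i dy) · √(π/(4π Im Z λ²))` — the stabiliser is trivial,
the orbit integral is over all of `ℍ`, and Shintani's evaluation gives the complete period of `φ`
between the two cusps (`ShintaniOrbitIntegrals.integral_sectorSet_Ioi_eq_mul_sqrt`).
[cite: Shintani1975, §2, Prop. 2.4 and proof of Prop. 2.3] -/
theorem orbitIntegral_split (hD : Odd D) (f : CuspForm (Gamma0 64) 2) (z : ℍ)
    (ω : orbitRel.Quotient (Gamma0Plus 64) (Fin 3 → ℤ)) {m₀ : ℤ} (hm₀ : 0 < m₀)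
    (hΔ : intDisc ω.out = m₀ ^ 2) :
    ∃ (M : SL(2, ℝ)) (lam : ℝ), lam ≠ 0 ∧ actSL M (latSharp ω.out) = xyForm lam ∧
      orbitIntegral D f z ω = anisoConst D z ω.out lam *
        (∫ r in Ioi (0 : ℝ), slashSL f M (polarPt r (π / 2)) * unitAt (π / 2)) *
          (Real.sqrt (π / (4 * π * (zScaled D z : ℂ).im * lam ^ 2)) : ℝ) := by
  set k₀ := ω.out with hk₀
  have hposR : 0 < disc (latSharp k₀) := by
    rw [disc_latSharp_eq_intDisc, hΔ]; push_cast; exact pow_pos (by exact_mod_cast hm₀) 2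
  obtain ⟨a, b, c, d, lam, hdet, hlam, hconj⟩ := exists_conj_to_xyForm hposR
  set M : SL(2, ℝ) := slOf a b c d hdet with hMdef
  have hM : actSL M (latSharp k₀) = xyForm lam := by rw [hMdef, actSL_slOf]; exact hconj
  refine ⟨M, lam, hlam, hM, ?_⟩
  obtain ⟨⟨A, Nu, hN, hMfac⟩, ⟨A', Nu', hN', hPfac⟩⟩ := exists_factorizations_of_sq hm₀ hΔ hM
  -- trivial stabiliser: `orbitDomain` and `univ` are both fundamental domains
  have hbot := stabK_eq_bot_of_sq hm₀ hΔ (k₀ := k₀)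
  haveI : Subsingleton (stabK k₀) := by rw [hbot]; infer_instance
  have hFD := isFundamentalDomain_orbitDomain k₀
  have hFD' : IsFundamentalDomain (stabK k₀) (Set.univ : Set ℍ) (volume : Measure ℍ) :=
    isFundamentalDomain_univ_of_subsingleton
  have hinv : ∀ (γ : stabK k₀) (w : ℍ), liftTerm D f z k₀ (γ • w) = liftTerm D f z k₀ w :=
    liftTerm_stab_invariant D hD f z k₀
  -- integrability on `ℍ`, transported and moved to the plane
  have hintH : IntegrableOn (liftTerm D f z k₀) Set.univ (volume : Measure ℍ) :=
    (hFD.integrableOn_iff hFD' hinv).mp (tsum_quotient_integral_liftTerm_eq hD f z k₀).1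
  have hintM : IntegrableOn (fun u ↦ liftTerm D f z k₀ (M • u)) Set.univ (volume : Measure ℍ) := by
    rw [← integrableOn_sl_smul_set_real_iff M, Set.smul_set_univ]; exact hintH
  set ψ : ℂ → ℂ := fun τ ↦ slashSL f M τ * anisoConst D z k₀ lam with hψdef
  set cc : ℝ := 4 * π * (zScaled D z : ℂ).im * lam ^ 2 with hcc
  have hcpos : 0 < cc := by
    have h1 : 0 < (zScaled D z : ℂ).im := by rw [UpperHalfPlane.coe_im]; exact (zScaled D z).im_pos
    positivity
  have hplane_eq : ∀ w : ℂ, 0 < w.im →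
      ((1 / w.im ^ 2 : ℝ) : ℂ) * liftTerm D f z k₀ (M • UpperHalfPlane.ofComplex w) = planeIntegrand ψ cc w := by
    intro w hw
    rw [liftTerm_sl_smul f z hM, planeIntegrand, UpperHalfPlane.ofComplex_apply_of_im_pos hw]
  have hplane : IntegrableOn (planeIntegrand ψ cc) {w : ℂ | 0 < w.im} := by
    have h := (FdCoord.integrableOn_image_iff (fun u ↦ liftTerm D f z k₀ (M • u)) MeasurableSet.univ).mpr hintM
    rw [image_univ, UpperHalfPlane.range_coe] at h
    exact h.congr_fun (fun w hw ↦ hplane_eq w hw) (measurableSet_lt measurable_const Complex.measurable_im)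
  -- the sibling's evaluation
  obtain ⟨C₀, -, hC₀⟩ := exists_norm_mul_im_le f
  have hCψ : ∀ w : ℂ, 0 < w.im → ‖ψ w‖ * w.im ≤ C₀ * ‖anisoConst D z k₀ lam‖ := by
    intro w hw
    calc ‖slashSL f M w * anisoConst D z k₀ lam‖ * w.im
        = (‖slashSL f M w‖ * w.im) * ‖anisoConst D z k₀ lam‖ := by rw [norm_mul]; ring
      _ ≤ C₀ * ‖anisoConst D z k₀ lam‖ :=
        mul_le_mul_of_nonneg_right (norm_slashSL_mul_im_le f M hC₀ hw) (norm_nonneg _)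
  have hψhol : DifferentiableOn ℂ ψ {w : ℂ | 0 < w.im} := (differentiableOn_slashSL f M).mul_const _
  have key := integral_sectorSet_Ioi_eq_mul_sqrt (ψ := ψ) (c := cc) hψhol hCψ
    (fun y hy ↦ tendsto_slashSL_mul_nhdsGT_zero f hN' hPfac _ hy)
    (fun y hy ↦ tendsto_slashSL_mul_atTop f hN hMfac _ hy)
    (fun θ hθ ↦ integrableOn_ray f hN hMfac hN' hPfac _ hθ)
    (integrableOn_polarIntegrand_of_plane hψhol.continuousOn hplane)
  -- assemble
  unfold orbitIntegral
  rw [← hk₀, hFD.setIntegral_eq hFD' hinv, ← Set.smul_set_univ (a := M), setIntegral_sl_smul_set_real,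
    FdCoord.setIntegral_eq_setIntegral_image _ MeasurableSet.univ, image_univ, UpperHalfPlane.range_coe]
  rw [show (UpperHalfPlane.upperHalfPlaneSet : Set ℂ) = {w : ℂ | 0 < w.im} from rfl,
    setIntegral_congr_fun (measurableSet_lt measurable_const Complex.measurable_im) (fun w hw ↦ hplane_eq w hw),
    setOf_im_pos_eq_sectorSet, key]
  -- pull the constant out of the ray integral
  have hray : ∫ r in Ioi (0 : ℝ), ψ (polarPt r (π / 2)) * unitAt (π / 2) =
      anisoConst D z k₀ lam * ∫ r in Ioi (0 : ℝ), slashSL f M (polarPt r (π / 2)) * unitAt (π / 2) := by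
    rw [← integral_const_mul]
    refine integral_congr_ae (Eventually.of_forall fun r ↦ ?_)
    simp only [hψdef]; ring
  rw [hray]

end Literature.NumberTheory.EllipticCurves.Shintani
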